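import Literature.NumberTheory.LFunctions.Zhang2022.KnifeEdgeRoughOverhang

/-!
# Zhang (2022), barrier-extension programme — the THRESHOLD of the smooth two-piece class:
# `Null θ X ↔ CompletedCS θ X`, i.e. «closes by positivity in the world `X`» ↔ «completed Cauchy–Schwarz fails»

Trunk T-ANT (NumberTheory/LFunctions). Y. Zhang, *Discrete mean estimates and the Landau–Siegel zero*,
arXiv:2211.02515v1 (2022) [Zhang2022LandauSiegel] — **an unrefereed manuscript under adjudication. WHAT THIS
IS NOT: nothing here asserts or denies its Theorems 1–2 or any analytic lemma; no claim about Landau–Siegel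
zeros, about Parity, or about a repaired `Margin232` is made.** Cell `landau-siegel` (rung F-S3), sub-cell E,
seat p1, stub S-E-p1-6 of barrier/ASSIGNMENTS.md (a THRESHOLD, not an extension: bundle kind THRESHOLD — no
class is «decided» or «killed» here).

p442741 (`KnifeEdgeOverhangRankOne`) typed, for the smooth two-piece designs `s·u ⊕ v` of length `θ` in an
off-diagonal world `X`, the bare shapes `KnifeEdge.Null θ X` (the completed constant `twoPieceMainTerm` is `≥ 0`
on every design), `KnifeEdge.ClosesByPositivity θ X` (some design has a negative constant) and
`KnifeEdge.CompletedCS θ X` (the discriminant condition `‖πΦ̄_vL(u) + X(u,v)‖² ≤ 𝔅(u)·(Re 𝔅_θ(v) + 2Re X(v,v))`),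
and proved `Null → KernelModeCancellation`, `InvisibleOverhang → Null ∧ CompletedCS`. p457552
(`KnifeEdgeRoughOverhang`) proved the exact criterion on ANY piece class `V`:
`KnifeEdge.nullOn_iff : NullOn V θ X ↔ BandNonnegOn V θ X ∧ CrossSubordinateOn V θ X`, with
`Null θ X ↔ NullOn (OverhangPiece θ) θ X` by `Iff.rfl`. This file closes the loop for the smooth class:

* `completedCS_iff_crossSubordinateOn` — `CompletedCS θ X` IS `CrossSubordinateOn (OverhangPiece θ) θ X`
  (the same inequality; `crossResidual`, `netOverhangBlock` are its two sides by definition);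
* `inClassPiece_kappaP_one`, `mainTermForm_kappaP_one_pos` — the length-`P` piece `ϰ_{1,5/2}`
  (`Repair.kappaP 1 (5/2)`) is an in-class piece with `𝔅(ϰ_{1,5/2}) > 0.19203 > 0`
  (`Repair.lengthKnifeEdge_control_one`, p428360: a certified 𝔅-value) — the ONE in-class profile with positive
  bulk form that the direction `CompletedCS → BandNonneg` needs (`‖c‖² ≤ 𝔅(u₀)·r` with `𝔅(u₀) > 0` forces `r ≥ 0`);
* `bandNonnegOn_of_completedCS`, **`null_iff_completedCS : Null θ X ↔ CompletedCS θ X`** and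
  **`closesByPositivity_iff_not_completedCS : ClosesByPositivity θ X ↔ ¬ CompletedCS θ X`** — for EVERY `θ`
  and EVERY world `X` (no hypothesis `1 ≤ θ` is needed: the statements are algebraic in the three blocks).

Reading (the §E sentence for any B-len word on the smooth two-piece family): «a smooth two-piece design closes
by positivity in the world `X` iff the completed Cauchy–Schwarz inequality of that world fails for some design»
— the lever is exactly a cross residual of E*-strength (registry E-006) or a negative net overhang block
(E-005), cf. `KnifeEdge.rough_closes_needs_cross`. CURRENCY (REF-E C3(e)): continued calculus past `P`
(`Repair.MformTop θ`) in an abstract world `X`; whether any `X` is the (A)-world off-diagonal main term of a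
design is registry E-017 / E-002, open — not claimed; the (L-b) question «is the true tail invisible beyond
`P`» is untouched.

Theorems only (no `def`, no new `Prop` fact), standard axioms.

## References

* Y. Zhang, arXiv:2211.02515v1 (2022), §7 Prop. 7.1, (7.2) [p. 44], §8 (8.11)–(8.12), (2.23)–(2.25) [p. 9].
  [cite: Zhang2022LandauSiegel, §7 (7.2) p.44; §8 (8.11)–(8.12)]
-/

noncomputable section

open Real Complex ComplexConjugate Set
open _root_.MeasureTheory

namespace Literature.NumberTheory.LFunctions.Zhang2022

namespace KnifeEdge

open Repair

variable {θ : ℝ} {X : PairFunctional}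

/-! ### `CompletedCS` is the cross-subordination slot on the smooth class -/

/-- **`CompletedCS θ X ↔ CrossSubordinateOn (OverhangPiece θ) θ X`**: p442741's completed Cauchy–Schwarz shape
is p457552's cross-subordination slot instantiated at the smooth overhang class — literally the same inequality
`‖πΦ̄_vL(u) + X(u,v)‖² ≤ 𝔅(u)·(Re 𝔅_θ(v) + 2Re X(v,v))` (`crossResidual`, `netOverhangBlock` unfold to its two
sides). [cite: Zhang2022LandauSiegel, §7 Prop 7.1 p.44, (7.2)] -/
theorem completedCS_iff_crossSubordinateOn :
    CompletedCS θ X ↔ CrossSubordinateOn (OverhangPiece θ) θ X := Iff.rfl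

/-! ### One in-class piece with positive bulk form: `ϰ_{1,5/2}` -/

/-- The length-`P` `ϰ`-piece `ϰ_{1,k}` (`Repair.kappaP 1 k`: `(1 − y)e^{iπk(1−y)}` on `[0,1]`, `0` beyond) is an
in-class piece for every shift `k`. [cite: Zhang2022LandauSiegel, (2.23)–(2.25) p.9; §7 (7.2) p.44] -/
theorem inClassPiece_kappaP_one (k : ℝ) : InClassPiece (kappaP 1 k) (kappaP' 1 k) where
  kinked := kinkedProfile_kappaP one_pos le_rfl
  vanish := fun _ hy => kappaP_of_ge one_ne_zero hy
  vanish' := fun _ hy => kappaP'_of_ge hy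

/-- **A positive bulk value on the in-class side**: `𝔅(ϰ_{1,5/2}) > 0` (indeed `> 0.19203`, the certified
enclosure `Repair.lengthKnifeEdge_control_one`, p428360). [cite: Zhang2022LandauSiegel, (2.23)–(2.25) p.9; §7 (7.2) p.44] -/
theorem mainTermForm_kappaP_one_pos : 0 < mainTermForm (kappaP 1 (5/2)) (kappaP' 1 (5/2)) :=
  lt_trans (by norm_num) lengthKnifeEdge_control_one.1

/-! ### The threshold -/

/-- **Completed Cauchy–Schwarz forces non-negative net overhang blocks** on the smooth class: test the
subordination `‖c_X(u₀,v)‖² ≤ 𝔅(u₀)·r_X(v)` with the in-class piece `u₀ = ϰ_{1,5/2}`, `𝔅(u₀) > 0`.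
[cite: Zhang2022LandauSiegel, §7 Prop 7.1 p.44, (7.2)] -/
theorem bandNonnegOn_of_completedCS (h : CompletedCS θ X) : BandNonnegOn (OverhangPiece θ) θ X := by
  intro v v' hv
  have key := h _ _ v v' (inClassPiece_kappaP_one (5/2)) hv
  have hpos := mainTermForm_kappaP_one_pos
  have h0 : 0 ≤ ‖(π : ℂ) * conj (overhangMass θ v) * tailFunctional (kappaP 1 (5/2))
      + X (kappaP 1 (5/2)) (kappaP' 1 (5/2)) v v'‖ ^ 2 := sq_nonneg _
  unfold netOverhangBlock
  by_contra hr
  push Not at hr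
  have : mainTermForm (kappaP 1 (5/2)) (kappaP' 1 (5/2)) *
      ((topDiagForm θ v v').re + 2 * (X v v' v v').re) < 0 := mul_neg_of_pos_of_neg hpos hr
  linarith

/-- **THRESHOLD `Null θ X ↔ CompletedCS θ X`** (every `θ`, every world `X`): the completed two-piece constant is
`≥ 0` on every smooth design `s·u ⊕ v` iff the completed Cauchy–Schwarz inequality holds on every such design.
(`→`: p457552's exact criterion `nullOn_iff` at `V = OverhangPiece θ`, second component; `←`: the criterion's
converse with the band sign supplied by `bandNonnegOn_of_completedCS`.) [cite: Zhang2022LandauSiegel, §7 Prop 7.1 p.44, (7.2)] -/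
theorem null_iff_completedCS : Null θ X ↔ CompletedCS θ X := by
  rw [null_iff_nullOn, nullOn_iff, completedCS_iff_crossSubordinateOn]
  exact ⟨fun h => h.2, fun h => ⟨bandNonnegOn_of_completedCS h, h⟩⟩

/-- **`ClosesByPositivity θ X ↔ ¬ CompletedCS θ X`**: a smooth two-piece design with a NEGATIVE completed constant
exists in the world `X` iff the completed Cauchy–Schwarz inequality of `X` fails for some design — the §E
sentence for the smooth two-piece family: closing by positivity IS an E*-strength violation of completed CS
(a cross residual beating `𝔅(u)·r_X(v)`, registry E-006, or a negative net overhang block, E-005).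
[cite: Zhang2022LandauSiegel, §7 Prop 7.1 p.44, (7.2)] -/
theorem closesByPositivity_iff_not_completedCS : ClosesByPositivity θ X ↔ ¬ CompletedCS θ X := by
  rw [closesByPositivity_iff_closesOn, closesByPositivityOn_iff_not_nullOn, ← null_iff_nullOn,
    null_iff_completedCS]

/-- In particular the continued calculus `X = 0` violates completed Cauchy–Schwarz at every `θ > 1`
(`Repair.closesByPositivity_zero`, p456612): some smooth design has `‖πΦ̄_vL(u)‖² > 𝔅(u)·Re 𝔅_θ(v)` there.
[cite: Zhang2022LandauSiegel, §7 Prop 7.1 p.44, (7.2)] -/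
theorem not_completedCS_zero (hθ : 1 < θ) : ¬ CompletedCS θ 0 :=
  closesByPositivity_iff_not_completedCS.1 (closesByPositivity_zero hθ)

end KnifeEdge

end Literature.NumberTheory.LFunctions.Zhang2022
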